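import Summits.ResolutionOfSingularities.ResolutionOfSingularities.Theorems.FrobeniusLadderFInjectiveMacaulayficationReesChartFacts
import Summits.ResolutionOfSingularities.ResolutionOfSingularities.Theorems.FrobeniusLadderFInjectiveMacaulayficationFCentreE1RungZero
import Mathlib.RingTheory.Localization.LocalizationLocalization
import HarnessLib

/-!
# F4POS-1 (d): the chart `D(z̄)` of `Bl_τ(P2d4C)` is the open `X ∖ V(z̄)` — its chart ring is ALL of `A₀[1/z̄]`, hence Cohen–Macaulay at every prime
# (crux `FInjectiveMacaulayfication` stmt-ResolutionOfSingularities-15315, chain w45a; res-L1-w45a-plan-1 R18.17 (b) «state CM/regularity on D(z) too or show it lies off the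
# closed fibre»; seat res-L1-w45a-stub-1 g10)

[OURS · L1 W4.5a] Support file (`--supports stmt-ResolutionOfSingularities-15315 --as helper`); def-free, unconditional; replaces the role of NO printed item;
NOT a statement of the manuscript; AI-written (AI review is weaker than expert review).

`A₀ = k[X₀..X₄]/(f)`, `f = z² + x⁴z + y³ + u³ + t³` (char 2), `τ = (x̄², ȳ, ū, t̄, z̄)`. On the chart `D(z̄)`: `f/z² = 1 + z·((x²/z)² + (y/z)³ + (u/z)³ + (t/z)³)`
(`x⁴/z = (x²/z)²·z`), so `z̄/1` is a UNIT of `A₀[τ/z̄]`: `blowupAlgebra_z_eq_top` — `A₀[τ/z̄] = A₀[1/z̄]` (the chart misses the exceptional divisor). Hence every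
localisation of the chart ring at a prime is a localisation of the hypersurface ring `A₀` (`IsLocalization` of a localisation), Cohen–Macaulay by
`DoublePointFermatCubicGerm.cmCl_localization_hypersurface`: ★ `cmCl_localization_blowupAlgebra_z`, and in the Proj chart model ★ `cmCl_localization_reesChart_z`
(`ReesChartFacts`). [folklore]
-/

-- single-problem summit: the doubled namespace component is forced
set_option linter.dupNamespace false

noncomputable section

namespace Summit.ResolutionOfSingularities.ResolutionOfSingularities.Theorems.FInjectiveMacaulayfication.TauFloorOneZChart

open MvPolynomial IsLocalRing IsLocalization Literature.AlgebraicGeometry.Resolution AlgebraicGeometry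
open Summit.ResolutionOfSingularities.ResolutionOfSingularities.Theorems.FInjectiveMacaulayfication
open SliceableCentre

variable (k : Type) [Field k]

set_option synthInstance.maxHeartbeats 200000 in
set_option maxHeartbeats 1600000 in
-- `Localization.Away` over the quotient ring: slow instances (cf. `…TauFloorOneCIChartDomain`)
/-- ★ **`A₀[τ/z̄] = A₀[1/z̄]`**: `1/z̄ = −((x̄²/z̄)² + (ȳ/z̄)³ + (ū/z̄)³ + (t̄/z̄)³) ∈ A₀[τ/z̄]` (from `f = 0`), and `A₀[1/z̄]` is generated over `A₀` by `1/z̄`. [folklore] -/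
theorem blowupAlgebra_z_eq_top (f : MvPolynomial (Fin 5) k) (hf : f = X 4 ^ 2 + X 0 ^ 4 * X 4 + X 1 ^ 3 + X 2 ^ 3 + X 3 ^ 3) :
    blowupAlgebra (Ideal.span {Ideal.Quotient.mk (Ideal.span {f}) (X 0) ^ 2, Ideal.Quotient.mk (Ideal.span {f}) (X 1),
      Ideal.Quotient.mk (Ideal.span {f}) (X 2), Ideal.Quotient.mk (Ideal.span {f}) (X 3), Ideal.Quotient.mk (Ideal.span {f}) (X 4)} :
        Ideal (MvPolynomial (Fin 5) k ⧸ Ideal.span {f})) (Ideal.Quotient.mk (Ideal.span {f}) (X 4)) = ⊤ := by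
  set B := blowupAlgebra (Ideal.span {Ideal.Quotient.mk (Ideal.span {f}) (X 0) ^ 2, Ideal.Quotient.mk (Ideal.span {f}) (X 1),
      Ideal.Quotient.mk (Ideal.span {f}) (X 2), Ideal.Quotient.mk (Ideal.span {f}) (X 3), Ideal.Quotient.mk (Ideal.span {f}) (X 4)} :
        Ideal (MvPolynomial (Fin 5) k ⧸ Ideal.span {f})) (Ideal.Quotient.mk (Ideal.span {f}) (X 4)) with hB
  -- the relation `f = 0` in `A₀[1/z̄]`
  have hF : algebraMap (MvPolynomial (Fin 5) k ⧸ Ideal.span {f}) (Localization.Away (Ideal.Quotient.mk (Ideal.span {f}) (X 4) :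
      MvPolynomial (Fin 5) k ⧸ Ideal.span {f})) (Ideal.Quotient.mk (Ideal.span {f}) (X 4)) ^ 2 +
      algebraMap (MvPolynomial (Fin 5) k ⧸ Ideal.span {f}) (Localization.Away (Ideal.Quotient.mk (Ideal.span {f}) (X 4) :
        MvPolynomial (Fin 5) k ⧸ Ideal.span {f})) (Ideal.Quotient.mk (Ideal.span {f}) (X 0)) ^ 4 *
      algebraMap (MvPolynomial (Fin 5) k ⧸ Ideal.span {f}) (Localization.Away (Ideal.Quotient.mk (Ideal.span {f}) (X 4) :
        MvPolynomial (Fin 5) k ⧸ Ideal.span {f})) (Ideal.Quotient.mk (Ideal.span {f}) (X 4)) +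
      algebraMap (MvPolynomial (Fin 5) k ⧸ Ideal.span {f}) (Localization.Away (Ideal.Quotient.mk (Ideal.span {f}) (X 4) :
        MvPolynomial (Fin 5) k ⧸ Ideal.span {f})) (Ideal.Quotient.mk (Ideal.span {f}) (X 1)) ^ 3 +
      algebraMap (MvPolynomial (Fin 5) k ⧸ Ideal.span {f}) (Localization.Away (Ideal.Quotient.mk (Ideal.span {f}) (X 4) :
        MvPolynomial (Fin 5) k ⧸ Ideal.span {f})) (Ideal.Quotient.mk (Ideal.span {f}) (X 2)) ^ 3 +
      algebraMap (MvPolynomial (Fin 5) k ⧸ Ideal.span {f}) (Localization.Away (Ideal.Quotient.mk (Ideal.span {f}) (X 4) :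
        MvPolynomial (Fin 5) k ⧸ Ideal.span {f})) (Ideal.Quotient.mk (Ideal.span {f}) (X 3)) ^ 3 = 0 := by
    have h0 : Ideal.Quotient.mk (Ideal.span {f}) (X 4 ^ 2 + X 0 ^ 4 * X 4 + X 1 ^ 3 + X 2 ^ 3 + X 3 ^ 3) = 0 := by
      rw [← hf]; exact Ideal.Quotient.eq_zero_iff_mem.mpr (Ideal.mem_span_singleton_self f)
    have := congrArg (algebraMap (MvPolynomial (Fin 5) k ⧸ Ideal.span {f})
      (Localization.Away (Ideal.Quotient.mk (Ideal.span {f}) (X 4) : MvPolynomial (Fin 5) k ⧸ Ideal.span {f}))) h0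
    simpa only [map_add, map_mul, map_pow, map_zero] using this
  have hzi : algebraMap (MvPolynomial (Fin 5) k ⧸ Ideal.span {f}) (Localization.Away (Ideal.Quotient.mk (Ideal.span {f}) (X 4) :
      MvPolynomial (Fin 5) k ⧸ Ideal.span {f})) (Ideal.Quotient.mk (Ideal.span {f}) (X 4)) * Away.invSelf (Ideal.Quotient.mk (Ideal.span {f}) (X 4)) = 1 :=
    Away.mul_invSelf _
  -- the four generators `x̄²/z̄, ȳ/z̄, ū/z̄, t̄/z̄` of `B`
  have hgen : ∀ g : MvPolynomial (Fin 5) k ⧸ Ideal.span {f},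
      g ∈ (Ideal.span {Ideal.Quotient.mk (Ideal.span {f}) (X 0) ^ 2, Ideal.Quotient.mk (Ideal.span {f}) (X 1),
        Ideal.Quotient.mk (Ideal.span {f}) (X 2), Ideal.Quotient.mk (Ideal.span {f}) (X 3), Ideal.Quotient.mk (Ideal.span {f}) (X 4)} : Ideal _) →
      algebraMap _ (Localization.Away (Ideal.Quotient.mk (Ideal.span {f}) (X 4) : MvPolynomial (Fin 5) k ⧸ Ideal.span {f})) g *
        Away.invSelf (Ideal.Quotient.mk (Ideal.span {f}) (X 4)) ∈ B := fun g hg => div_mem_blowupAlgebra _ _ hg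
  have ha := hgen _ (Ideal.subset_span (by simp : Ideal.Quotient.mk (Ideal.span {f}) (X 0) ^ 2 ∈ _))
  have hy := hgen _ (Ideal.subset_span (by simp : Ideal.Quotient.mk (Ideal.span {f}) (X 1) ∈ _))
  have hu := hgen _ (Ideal.subset_span (by simp : Ideal.Quotient.mk (Ideal.span {f}) (X 2) ∈ _))
  have ht := hgen _ (Ideal.subset_span (by simp : Ideal.Quotient.mk (Ideal.span {f}) (X 3) ∈ _))
  rw [map_pow] at ha
  -- generalize the atoms
  generalize (Away.invSelf (Ideal.Quotient.mk (Ideal.span {f}) (X 4) : MvPolynomial (Fin 5) k ⧸ Ideal.span {f}) :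
    Localization.Away (Ideal.Quotient.mk (Ideal.span {f}) (X 4) : MvPolynomial (Fin 5) k ⧸ Ideal.span {f})) = i at hzi ha hy hu ht ⊢
  generalize algebraMap (MvPolynomial (Fin 5) k ⧸ Ideal.span {f}) (Localization.Away (Ideal.Quotient.mk (Ideal.span {f}) (X 4) :
      MvPolynomial (Fin 5) k ⧸ Ideal.span {f})) (Ideal.Quotient.mk (Ideal.span {f}) (X 0)) = a0 at hF ha
  generalize algebraMap (MvPolynomial (Fin 5) k ⧸ Ideal.span {f}) (Localization.Away (Ideal.Quotient.mk (Ideal.span {f}) (X 4) :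
      MvPolynomial (Fin 5) k ⧸ Ideal.span {f})) (Ideal.Quotient.mk (Ideal.span {f}) (X 1)) = a1 at hF hy
  generalize algebraMap (MvPolynomial (Fin 5) k ⧸ Ideal.span {f}) (Localization.Away (Ideal.Quotient.mk (Ideal.span {f}) (X 4) :
      MvPolynomial (Fin 5) k ⧸ Ideal.span {f})) (Ideal.Quotient.mk (Ideal.span {f}) (X 2)) = a2 at hF hu
  generalize algebraMap (MvPolynomial (Fin 5) k ⧸ Ideal.span {f}) (Localization.Away (Ideal.Quotient.mk (Ideal.span {f}) (X 4) :
      MvPolynomial (Fin 5) k ⧸ Ideal.span {f})) (Ideal.Quotient.mk (Ideal.span {f}) (X 3)) = a3 at hF ht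
  have hzi' := hzi
  generalize algebraMap (MvPolynomial (Fin 5) k ⧸ Ideal.span {f}) (Localization.Away (Ideal.Quotient.mk (Ideal.span {f}) (X 4) :
      MvPolynomial (Fin 5) k ⧸ Ideal.span {f})) (Ideal.Quotient.mk (Ideal.span {f}) (X 4)) = a4 at hF hzi
  -- `1/z̄ ∈ B`: `i = −((x̄²/z̄)² + (ȳ/z̄)³ + (ū/z̄)³ + (t̄/z̄)³)` (multiply `f = 0` by `i³`)
  have hi : i = -((a0 ^ 2 * i) ^ 2 + (a1 * i) ^ 3 + (a2 * i) ^ 3 + (a3 * i) ^ 3) := by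
    linear_combination (i ^ 3) * hF - (i * (a4 * i + 1) + a0 ^ 4 * i ^ 2) * hzi
  have hiB : i ∈ B := by
    rw [hi]
    exact B.neg_mem (B.add_mem (B.add_mem (B.add_mem (B.pow_mem ha 2) (B.pow_mem hy 3)) (B.pow_mem hu 3)) (B.pow_mem ht 3))
  rw [eq_top_iff]
  rintro x -
  -- every element of `A₀[1/z̄]` is `a · iⁿ`
  obtain ⟨a, s, rfl⟩ := IsLocalization.exists_mk'_eq
    (Submonoid.powers (Ideal.Quotient.mk (Ideal.span {f}) (X 4) : MvPolynomial (Fin 5) k ⧸ Ideal.span {f})) x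
  obtain ⟨n, hn⟩ := s.2
  have hs : IsLocalization.mk' (Localization.Away (Ideal.Quotient.mk (Ideal.span {f}) (X 4) : MvPolynomial (Fin 5) k ⧸ Ideal.span {f})) a s =
      algebraMap _ _ a * i ^ n := by
    rw [IsLocalization.mk'_eq_iff_eq_mul, ← hn, map_pow, mul_assoc, ← mul_pow, mul_comm i, hzi', one_pow, mul_one]
  rw [hs]
  exact B.mul_mem (B.algebraMap_mem a) (B.pow_mem hiB n)

/-! ## §2 Cohen–Macaulay at every prime of the chart ring `D(z̄)` -/

set_option synthInstance.maxHeartbeats 200000 in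
set_option maxHeartbeats 1600000 in
-- as above
/-- ★ **Every localisation at a prime of the chart ring `A₀[τ/z̄]` satisfies the CM clause**: it is a localisation of the hypersurface ring `A₀` at a prime
(`blowupAlgebra_z_eq_top` + localisation of a localisation), and those are CM (`DoublePointFermatCubicGerm.cmCl_localization_hypersurface`). [folklore] -/
theorem cmCl_localization_blowupAlgebra_z [CharP k 2] (f : MvPolynomial (Fin 5) k) (hf : f = X 4 ^ 2 + X 0 ^ 4 * X 4 + X 1 ^ 3 + X 2 ^ 3 + X 3 ^ 3)
    (Q : Ideal (blowupAlgebra (Ideal.span {Ideal.Quotient.mk (Ideal.span {f}) (X 0) ^ 2, Ideal.Quotient.mk (Ideal.span {f}) (X 1),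
      Ideal.Quotient.mk (Ideal.span {f}) (X 2), Ideal.Quotient.mk (Ideal.span {f}) (X 3), Ideal.Quotient.mk (Ideal.span {f}) (X 4)} :
        Ideal (MvPolynomial (Fin 5) k ⧸ Ideal.span {f})) (Ideal.Quotient.mk (Ideal.span {f}) (X 4)))) [Q.IsPrime] :
    CMCl (Localization.AtPrime Q) := by
  have htop := blowupAlgebra_z_eq_top k f hf
  -- the chart ring is all of `L = A₀[1/z̄]`
  let e := ((Subalgebra.equivOfEq _ _ htop).trans (Subalgebra.topEquiv (R := MvPolynomial (Fin 5) k ⧸ Ideal.span {f})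
    (A := Localization.Away (Ideal.Quotient.mk (Ideal.span {f}) (X 4) : MvPolynomial (Fin 5) k ⧸ Ideal.span {f})))).toRingEquiv
  -- CM at every prime of `L`: a localisation of `A₀` at a prime
  have hL : ∀ (q : Ideal (Localization.Away (Ideal.Quotient.mk (Ideal.span {f}) (X 4) : MvPolynomial (Fin 5) k ⧸ Ideal.span {f}))) [q.IsPrime],
      CMCl (Localization.AtPrime q) := by
    intro q _
    let P : Ideal (MvPolynomial (Fin 5) k ⧸ Ideal.span {f}) := q.comap (algebraMap _ (Localization.Away (Ideal.Quotient.mk (Ideal.span {f}) (X 4) :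
      MvPolynomial (Fin 5) k ⧸ Ideal.span {f})))
    haveI : P.IsPrime := Ideal.IsPrime.comap _
    have hCM : CMCl (Localization.AtPrime P) :=
      DoublePointFermatCubicGerm.cmCl_localization_hypersurface k f (FCentreE1ChartWitness.prime_f k f hf).ne_zero ⟨P, inferInstance⟩
    exact FiLocusOpenOfAffine.cmClause_of_ringEquiv
      (IsLocalization.algEquiv P.primeCompl (Localization.AtPrime P) (Localization.AtPrime q)).toRingEquiv hCM
  exact ReesChartFacts.transport_cmCl e.symm hL Q

/-- ★ The same in the Proj chart model `(A₀[τt])_{(z̄t)}` (`ReesChartFacts`). [folklore] -/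
theorem cmCl_localization_reesChart_z [CharP k 2] (f : MvPolynomial (Fin 5) k) (hf : f = X 4 ^ 2 + X 0 ^ 4 * X 4 + X 1 ^ 3 + X 2 ^ 3 + X 3 ^ 3)
    (hz : (Ideal.Quotient.mk (Ideal.span {f}) (X 4) : MvPolynomial (Fin 5) k ⧸ Ideal.span {f}) ∈
      (Ideal.span {Ideal.Quotient.mk (Ideal.span {f}) (X 0) ^ 2, Ideal.Quotient.mk (Ideal.span {f}) (X 1),
        Ideal.Quotient.mk (Ideal.span {f}) (X 2), Ideal.Quotient.mk (Ideal.span {f}) (X 3), Ideal.Quotient.mk (Ideal.span {f}) (X 4)} :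
          Ideal (MvPolynomial (Fin 5) k ⧸ Ideal.span {f})))
    (q : Ideal (HomogeneousLocalization.Away (reesGrading (Ideal.span {Ideal.Quotient.mk (Ideal.span {f}) (X 0) ^ 2,
      Ideal.Quotient.mk (Ideal.span {f}) (X 1), Ideal.Quotient.mk (Ideal.span {f}) (X 2), Ideal.Quotient.mk (Ideal.span {f}) (X 3),
      Ideal.Quotient.mk (Ideal.span {f}) (X 4)} : Ideal (MvPolynomial (Fin 5) k ⧸ Ideal.span {f}))) (reesT (Ideal.Quotient.mk (Ideal.span {f}) (X 4)) hz)))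
    [q.IsPrime] : CMCl (Localization.AtPrime q) :=
  ReesChartFacts.reesChart_cmCl_of_blowupAlgebra_cmCl _ _ hz (fun Q _ => cmCl_localization_blowupAlgebra_z k f hf Q) q

end Summit.ResolutionOfSingularities.ResolutionOfSingularities.Theorems.FInjectiveMacaulayfication.TauFloorOneZChart

end
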